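import Summits.NavierStokesRegularity.NavierStokesRegularity.Theses.TypeICertificateLadder
import Literature.Analysis.FluidPDE.TypeIAncientMildClassical
import Literature.Analysis.FluidPDE.AncientSimilarityVariables

/-!
# Candidate proof of S1b `stub_ancientPressure` (line `head-flux-channel`, crux stmt-NavierStokesRegularity-1217)

refuter-drefute-stmt-NavierStokesRegularity-1217-0, 2026-08-16 — CANDIDATE EVIDENCE for the lead / a prover to land
(`--supports stmt-NavierStokesRegularity-1217`); the refuter does not land positive statements.

`ancientPressure` below has EXACTLY the type of the skeleton's `stub_ancientPressure`: every
Type-I ancient mild field admits ONE classical pressure on the whole past `(-∞, 0)`. Proof: the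
tree's `IsTypeIAncientMild.exists_isClassicalNSSolutionOn_Ioo` gives a classical pressure `pₙ` on
each window `(-(n+1), 0)`; two classical pressures of the same velocity on a common open window have
equal gradients (momentum equation; the one-sided time derivatives agree on open sub-windows), hence
agree after the normalisation `p(t, 0) = 0` (`pressure_normalised_eq`); so
`q(t, x) := p_{⌊-t⌋}(t, x) - p_{⌊-t⌋}(t, 0)` equals `pₘ(t,x) - pₘ(t,0)` on every window containing
`t`, is therefore locally (hence globally) smooth on `(-∞,0) × ℝ³`, and satisfies the momentum
equation with the two-sided time derivative.
-/

noncomputable section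

namespace Summit.NavierStokesRegularity.NavierStokesRegularity.Theorems.HeadFluxChannelS1b

open MeasureTheory Set Filter Topology Function
open scoped RealInnerProductSpace ContDiff Laplacian
open Literature.Analysis.FluidPDE

set_option linter.dupNamespace false

/-- **Two classical pressures of one velocity on an open time set agree after normalisation at the
origin**: the momentum equation determines `∇p(t, ·)`, so `p(t,·) - p'(t,·)` is constant. [folklore] -/
theorem pressure_normalised_eq {S : Set ℝ} {ν : ℝ}
    {u : ℝ → EuclideanSpace ℝ (Fin 3) → EuclideanSpace ℝ (Fin 3)}
    {p p' : ℝ → EuclideanSpace ℝ (Fin 3) → ℝ}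
    (h : IsClassicalNSSolutionOn S ν 0 u p) (h' : IsClassicalNSSolutionOn S ν 0 u p') {t : ℝ}
    (ht : t ∈ S) (x : EuclideanSpace ℝ (Fin 3)) :
    p t x - p t 0 = p' t x - p' t 0 := by
  have hg : ∀ y, gradient (p t) y = gradient (p' t) y := by
    intro y
    have key := (h.momentum t ht y).symm.trans (h'.momentum t ht y)
    simpa using key
  have hd1 : Differentiable ℝ (p t) := (h.contDiff_pressure ht).differentiable (by simp)
  have hd2 : Differentiable ℝ (p' t) := (h'.contDiff_pressure ht).differentiable (by simp)
  have hf : ∀ y, fderiv ℝ (fun z => p t z - p' t z) y = 0 := by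
    intro y
    rw [fderiv_fun_sub (hd1 y) (hd2 y)]
    have hy := hg y
    unfold gradient at hy
    rw [(InnerProductSpace.toDual ℝ (EuclideanSpace ℝ (Fin 3))).symm.injective hy, sub_self]
  have hc : p t x - p' t x = p t 0 - p' t 0 :=
    is_const_of_fderiv_eq_zero (f := fun z => p t z - p' t z) (hd1.sub hd2) hf x 0
  linarith

/-- Every negative time lies in the window `(-(⌊-t⌋₊ + 1), 0)`. [folklore] -/
theorem mem_window {t : ℝ} (ht : t < 0) : t ∈ Ioo (-((⌊-t⌋₊ : ℕ) + 1 : ℝ)) 0 := by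
  refine ⟨?_, ht⟩
  have := Nat.lt_floor_add_one (-t)
  linarith

/-- **S1b — a global classical pressure for the rate class** (exact type of the skeleton's
`stub_ancientPressure`). -/
theorem ancientPressure :
    ∀ (C : ℝ) (u : ℝ → EuclideanSpace ℝ (Fin 3) → EuclideanSpace ℝ (Fin 3)),
      IsTypeIAncientMild C u →
      ∃ q : ℝ → EuclideanSpace ℝ (Fin 3) → ℝ, IsClassicalNSSolutionOn (Set.Iio 0) 1 0 u q := by
  intro C u hA
  have hwin : ∀ n : ℕ, ∃ p : ℝ → EuclideanSpace ℝ (Fin 3) → ℝ,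
      IsClassicalNSSolutionOn (Ioo (-((n : ℝ) + 1)) 0) 1 0 u p := fun n =>
    hA.exists_isClassicalNSSolutionOn_Ioo (by have : (0 : ℝ) ≤ n := n.cast_nonneg; linarith)
  choose p hp using hwin
  have hsmI : IsSmoothSpaceTimeOn (Iio 0) u := hA.contDiffOn
  -- agreement of the normalised window pressures
  have hagree : ∀ m : ℕ, ∀ t ∈ Ioo (-((m : ℝ) + 1)) 0, ∀ x : EuclideanSpace ℝ (Fin 3),
      p ⌊-t⌋₊ t x - p ⌊-t⌋₊ t 0 = p m t x - p m t 0 := by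
    intro m t ht x
    set k : ℕ := min ⌊-t⌋₊ m with hk
    have hk1 : (k : ℝ) ≤ ⌊-t⌋₊ := by exact_mod_cast min_le_left _ _
    have hk2 : (k : ℝ) ≤ m := by exact_mod_cast min_le_right _ _
    have hsub1 : Ioo (-((k : ℝ) + 1)) 0 ⊆ Ioo (-((⌊-t⌋₊ : ℕ) + 1 : ℝ)) 0 :=
      Ioo_subset_Ioo (by linarith) le_rfl
    have hsub2 : Ioo (-((k : ℝ) + 1)) 0 ⊆ Ioo (-((m : ℝ) + 1)) 0 :=
      Ioo_subset_Ioo (by linarith) le_rfl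
    have htk : t ∈ Ioo (-((k : ℝ) + 1)) 0 := by
      rcases min_choice ⌊-t⌋₊ m with hmin | hmin
      · rw [hk, hmin]; exact mem_window ht.2
      · rw [hk, hmin]; exact ht
    exact pressure_normalised_eq ((hp ⌊-t⌋₊).mono hsub1 (uniqueDiffOn_Ioo _ _))
      ((hp m).mono hsub2 (uniqueDiffOn_Ioo _ _)) htk x
  refine ⟨fun t x => p ⌊-t⌋₊ t x - p ⌊-t⌋₊ t 0, hsmI, ?_, ?_, fun t ht => hA.isDivFree ht⟩
  · -- joint smoothness of the patched pressure: it is locally one of the window pressures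
    refine contDiffOn_of_locally_contDiffOn fun z hz => ?_
    have ht : z.1 < 0 := (mem_prod.1 hz).1
    set m : ℕ := ⌊-z.1⌋₊ with hm
    refine ⟨Ioo (-((m : ℝ) + 1)) 0 ×ˢ univ, isOpen_Ioo.prod isOpen_univ,
      ⟨by rw [hm]; exact mem_window ht, mem_univ _⟩, ?_⟩
    have hP : ContDiffOn ℝ ∞ (uncurry (p m)) (Ioo (-((m : ℝ) + 1)) 0 ×ˢ univ) :=
      (hp m).smooth_pressure
    have hP0 : ContDiffOn ℝ ∞ (fun w : ℝ × EuclideanSpace ℝ (Fin 3) => uncurry (p m) (w.1, 0))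
        (Ioo (-((m : ℝ) + 1)) 0 ×ˢ univ) :=
      hP.comp (contDiffOn_fst.prodMk contDiffOn_const)
        (fun w hw => ⟨(mem_prod.1 hw).1, mem_univ _⟩)
    refine ((hP.sub hP0).mono fun w hw => hw.2).congr fun w hw => ?_
    exact hagree m w.1 (mem_prod.1 hw.2).1 w.2
  · -- momentum with the two-sided time derivative
    intro t ht x
    have htN := mem_window ht
    have hmom := (hp ⌊-t⌋₊).momentum t htN x
    have htd : timeDerivWithin (Ioo (-((⌊-t⌋₊ : ℕ) + 1 : ℝ)) 0) u t x =
        timeDerivWithin (Iio 0) u t x :=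
      hsmI.timeDerivWithin_eq_of_subset (fun s hs => hs.2) (uniqueDiffOn_Ioo _ _) htN x
    have hgrad : gradient (fun y => p ⌊-t⌋₊ t y - p ⌊-t⌋₊ t 0) x = gradient (p ⌊-t⌋₊ t) x := by
      simp only [gradient, fderiv_sub_const]
    rw [← htd, hgrad]
    exact hmom

end Summit.NavierStokesRegularity.NavierStokesRegularity.Theorems.HeadFluxChannelS1b

end
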